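import Literature.AlgebraicGeometry.Resolution.LogRegularDomain
import HarnessLib

/-!
# Chart elements of a log regular local ring are non-zero (Kato 1994, (4.1); Nizioł 2006, Lemma 2.4 (1))

`Literature/AlgebraicGeometry/Resolution/LogRegularChartNonzero.lean`. For a log regular
`(X, M)` the structure map `M → 𝒪_X` is injective (W. Nizioł, *Toric singularities: log-blow-ups
and global resolutions*, Lemma 2.4 (1); K. Kato, *Toric singularities*, proof of (4.1)): in the
completed picture `𝒪̂ ≅ R[[P]]/(θ)` ((3.2)) a monomial `x^w` is never a multiple of `θ`, because
`θ ≡ p mod (P ∖ 1)` with `p` a non-unit. We PROVE the consequence needed for the blow-up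
description of Kato's resolution: chart elements are NON-ZERO in the local rings `A_𝔭` (which are
domains, `LogRegularDomain.lean`), hence non-zero-divisors.

* `monomial_ne_theta_mul` — in `Λ⟦X⟧`, `x^w ≠ θ·g` when `θ(0)` is a non-unit non-zero-divisor;
* `chart_ne_zero_of_dform0` — d = 0 chart data on a Noetherian local ring: `φ(w) ≠ 0` for `w ∈ P`;
* `LogChart.algebraMap_val_ne_zero_of_isLogRegularAt` — **log regular at `𝔭` ⇒ `φ(p) ≠ 0` in
  `A_𝔭` for every `p ∈ P`.**

References: [Kato1994] K. Kato, Toric singularities, Amer. J. Math. 116 (1994), (3.2), (4.1);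
[Niziol2006] W. Nizioł, Toric singularities: log-blow-ups and global resolutions, J. Algebraic
Geom. 15 (2006), Lemma 2.4.
-/

noncomputable section

open IsLocalRing MvPowerSeries Literature.RingTheory.MvPowerSeries
  Literature.RingTheory.MvPowerSeries.monoidPowerSeries
  Literature.RingTheory.CompleteLocalRings

namespace Literature.AlgebraicGeometry.Resolution

namespace LogRegularCompleteStructure

universe u

/-! ### Monomials are not multiples of `θ` -/

/-- **`x^w ∉ (θ)`**: in `Λ⟦Xᵢ⟧`, if the constant coefficient of `θ` is a non-zero-divisor and
not a unit, then no monomial `x^w` equals `θ · g` (compare lowest-degree coefficients).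
[cite: Niziol2006, Lemma 2.4] -/
theorem monomial_ne_theta_mul {σ : Type*} {Λ : Type u} [CommRing Λ] (θ g : MvPowerSeries σ Λ)
    (hπ : MvPowerSeries.constantCoeff θ ∈ nonZeroDivisors Λ)
    (hπu : ¬IsUnit (MvPowerSeries.constantCoeff θ)) (w : σ →₀ ℕ) :
    MvPowerSeries.monomial w (1 : Λ) ≠ θ * g := by
  classical
  intro heq
  -- `g ≠ 0`
  have hg0 : g ≠ 0 := by
    intro h0
    rw [h0, mul_zero] at heq
    have h10 := congrArg (MvPowerSeries.coeff w) heq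
    rw [MvPowerSeries.coeff_monomial_same, map_zero] at h10
    haveI : Subsingleton Λ := subsingleton_of_zero_eq_one h10.symm
    exact hπu (isUnit_of_subsingleton _)
  -- an exponent of minimal degree in the support of `g`
  obtain ⟨v₁, hv₁⟩ : ∃ v, MvPowerSeries.coeff v g ≠ 0 := by
    by_contra h
    push Not at h
    exact hg0 (MvPowerSeries.ext fun v => by rw [h v, map_zero])
  have hex : ∃ m : ℕ, ∃ v, v.degree = m ∧ MvPowerSeries.coeff v g ≠ 0 := ⟨_, v₁, rfl, hv₁⟩
  let m₀ := Nat.find hex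
  obtain ⟨v₀, hv₀deg, hv₀⟩ : ∃ v, v.degree = m₀ ∧ MvPowerSeries.coeff v g ≠ 0 := Nat.find_spec hex
  have hmin : ∀ v : σ →₀ ℕ, v.degree < m₀ → MvPowerSeries.coeff v g = 0 := by
    intro v hv
    by_contra hne
    exact Nat.find_min hex hv ⟨v, rfl, hne⟩
  -- the coefficient of `θ g` at `v₀` is `θ(0) g(v₀)`
  have hcoeff : MvPowerSeries.coeff v₀ (θ * g) = MvPowerSeries.constantCoeff θ * MvPowerSeries.coeff v₀ g := by
    rw [MvPowerSeries.coeff_mul, Finset.sum_eq_single (0, v₀)]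
    · rw [MvPowerSeries.coeff_zero_eq_constantCoeff]
    · rintro ⟨a, b⟩ hab hne
      rw [Finset.HasAntidiagonal.mem_antidiagonal] at hab
      simp only at hab
      have ha0 : a ≠ 0 := by
        rintro rfl; rw [zero_add] at hab; exact hne (by rw [hab])
      have hb : b.degree < m₀ := by
        have hdeg : a.degree + b.degree = m₀ := by rw [← hv₀deg, ← hab, map_add]
        have : 0 < a.degree := by
          rw [pos_iff_ne_zero, Ne, Finsupp.degree_eq_zero_iff]; exact ha0
        omega
      simp only
      rw [hmin b hb, mul_zero]
    · intro h
      exact (h (Finset.HasAntidiagonal.mem_antidiagonal.2 (zero_add v₀))).elim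
  have h1 := congrArg (MvPowerSeries.coeff v₀) heq
  rw [hcoeff, MvPowerSeries.coeff_monomial] at h1
  split_ifs at h1 with hwv
  · -- `θ(0) g(w) = 1`: `θ(0)` would be a unit
    exact hπu (isUnit_iff_exists_inv.2 ⟨_, h1.symm⟩)
  · exact hv₀ ((mul_left_mem_nonZeroDivisors_eq_zero_iff hπ).1 h1.symm)

/-! ### Chart elements are non-zero -/

variable {A : Type u} [CommRing A] [IsLocalRing A] [IsNoetherianRing A] {M d : ℕ}
  {P : AddSubmonoid (Fin M →₀ ℕ)} {φ : (Fin M →₀ ℕ) → A}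

/-- **Chart elements are non-zero** for d = 0 chart data (`𝔪_A = (φ(P ∖ 0))`, `dim A = rank P`):
`φ(w) ≠ 0` for all `w ∈ P` (its image in `Â ≅ Λ⟦P⟧/(θ)` is the class of `x^w ∉ (θ)`).
[cite: Niziol2006, Lemma 2.4] [cite: Kato1994, Thm. (4.1)] -/
theorem chart_ne_zero_of_dform0 (hP : P.FG) (hφ0 : φ 0 = 1)
    (hφadd : ∀ a ∈ P, ∀ b ∈ P, φ (a + b) = φ a * φ b)
    (hφm : ∀ p ∈ P, p ≠ 0 → φ p ∈ maximalIdeal A)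
    (hgen : maximalIdeal A ≤ Ideal.span (φ '' {p | p ∈ P ∧ p ≠ 0}))
    (hdim : ringKrullDim A = rank P) {w : Fin M →₀ ℕ} (hw : w ∈ P) : φ w ≠ 0 := by
  classical
  haveI : IsNoetherianRing (AdicCompletion (maximalIdeal A) A) :=
    isNoetherianRing_adicCompletion_maximalIdeal A
  -- it suffices that the image in `Â` is non-zero
  suffices h : algebraMap A (AdicCompletion (maximalIdeal A) A) (φ w) ≠ 0 by
    intro h0; exact h (by rw [h0, map_zero])
  let φh : (Fin M →₀ ℕ) → AdicCompletion (maximalIdeal A) A := fun p => algebraMap A _ (φ p)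
  have hφh0 : φh 0 = 1 := by simp only [φh, hφ0, map_one]
  have hφhadd : ∀ a ∈ P, ∀ b ∈ P, φh (a + b) = φh a * φh b := by
    intro a ha b hb; simp only [φh, hφadd a ha b hb, map_mul]
  have hφhm : ∀ p ∈ P, p ≠ 0 → φh p ∈ maximalIdeal (AdicCompletion (maximalIdeal A) A) := by
    intro p hp hp0
    rw [AdicCompletion.maximalIdeal_eq_map]
    exact Ideal.mem_map_of_mem _ (hφm p hp hp0)
  have hgenh : maximalIdeal (AdicCompletion (maximalIdeal A) A) ≤
      Ideal.span (φh '' {p | p ∈ P ∧ p ≠ 0}) := by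
    rw [AdicCompletion.maximalIdeal_eq_map]
    refine (Ideal.map_mono hgen).trans ?_
    rw [Ideal.map_span, ← Set.image_comp]
    rfl
  have hdimh : ringKrullDim (AdicCompletion (maximalIdeal A) A) = rank P := by
    rw [ringKrullDim_adicCompletion A, hdim]
  show φh w ≠ 0
  obtain ⟨p, hp⟩ := CharP.exists (ResidueField (AdicCompletion (maximalIdeal A) A))
  rcases CharP.char_is_prime_or_zero (ResidueField (AdicCompletion (maximalIdeal A) A)) p with
    hprime | rfl
  · haveI : Fact p.Prime := ⟨hprime⟩
    obtain ⟨R, _, _, _, hRN, hRc, hmax, hp0, j, hres⟩ :=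
      exists_cohenDVR_ringHom (AdicCompletion (maximalIdeal A) A) p
    haveI := hRN
    haveI := hRc
    have hpA : (p : AdicCompletion (maximalIdeal A) A) ∈
        maximalIdeal (AdicCompletion (maximalIdeal A) A) := by
      rw [← residue_eq_zero_iff, map_natCast]; exact CharP.cast_eq_zero _ p
    haveI : IsLocalHom j := by
      refine ⟨fun r hr => ?_⟩
      by_contra hrn
      have hrm : r ∈ maximalIdeal R := (mem_maximalIdeal _).2 (mem_nonunits_iff.2 hrn)
      rw [hmax, Ideal.mem_span_singleton] at hrm
      obtain ⟨s, rfl⟩ := hrm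
      rw [map_mul, map_natCast] at hr
      exact ((mem_maximalIdeal _).1 (Ideal.mul_mem_right _ _ hpA)) hr
    obtain ⟨ψ, hψsurj, hψmon, hψC⟩ := exists_lift_surjective j hres hP φh hφh0 hφhadd hφhm hgenh
    have hjp : j (p : R) ∈ maximalIdeal _ := by rw [map_natCast]; exact hpA
    obtain ⟨θ, hθ, hθπ⟩ := exists_theta ψ hψsurj j hψC φh hψmon hgenh (p : R) hjp
    have hker := ker_eq_span_theta hp0 hmax hP ψ hψsurj hdimh θ hθ hθπ
    rw [← hψmon w hw]
    intro h0
    have hmem : (⟨MvPowerSeries.monomial w (1 : R), monomial_mem hw 1⟩ : monoidPowerSeries R P) ∈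
        RingHom.ker ψ := h0
    rw [hker, Ideal.mem_span_singleton'] at hmem
    obtain ⟨g, hg⟩ := hmem
    have hval := congrArg (Subtype.val) hg
    rw [Subalgebra.coe_mul] at hval
    refine monomial_ne_theta_mul (θ : MvPowerSeries (Fin M) R) (g : MvPowerSeries (Fin M) R) ?_ ?_ w ?_
    · rw [hθπ]; exact mem_nonZeroDivisors_of_ne_zero hp0
    · rw [hθπ]; exact (mem_maximalIdeal _).1 (hmax ▸ Ideal.subset_span rfl)
    · rw [mul_comm]; exact hval.symm
  · haveI : CharZero (ResidueField (AdicCompletion (maximalIdeal A) A)) := CharP.charP_to_charZero _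
    obtain ⟨σ, hσ⟩ := exists_coefficientField_of_charZero (AdicCompletion (maximalIdeal A) A)
    have hbot : maximalIdeal (ResidueField (AdicCompletion (maximalIdeal A) A)) = ⊥ :=
      (IsLocalRing.isField_iff_maximalIdeal_eq).1 (Field.toIsField _)
    haveI : IsAdicComplete (maximalIdeal (ResidueField (AdicCompletion (maximalIdeal A) A)))
        (ResidueField (AdicCompletion (maximalIdeal A) A)) := by rw [hbot]; infer_instance
    haveI : IsLocalHom σ := by
      refine ⟨fun x hx => ?_⟩
      by_contra hxn
      have hx0 : x = 0 := by by_contra h; exact hxn (Ne.isUnit h)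
      rw [hx0, map_zero] at hx
      exact not_isUnit_zero hx
    have hres : ∀ a : AdicCompletion (maximalIdeal A) A, ∃ l, a - σ l ∈ maximalIdeal _ :=
      fun a => ⟨residue _ a, by rw [← residue_eq_zero_iff, map_sub, hσ, sub_self]⟩
    obtain ⟨ψ, hψsurj, hψmon, -⟩ := exists_lift_surjective σ hres hP φh hφh0 hφhadd hφhm hgenh
    have hker := ker_eq_bot_of_field hP ψ hψsurj hdimh
    rw [← hψmon w hw]
    intro h0
    have hmem : (⟨MvPowerSeries.monomial w (1 : ResidueField (AdicCompletion (maximalIdeal A) A)),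
        monomial_mem hw 1⟩ : monoidPowerSeries _ P) ∈ RingHom.ker ψ := h0
    rw [hker, Ideal.mem_bot] at hmem
    have := congrArg Subtype.val hmem
    rw [Subalgebra.coe_zero] at this
    have h1 := congrArg (MvPowerSeries.coeff w) this
    rw [MvPowerSeries.coeff_monomial_same, map_zero] at h1
    exact one_ne_zero h1

/-- **Chart elements are non-zero, d-form**: with parameters `t₁..t_d` (`𝔪 = (φ(P ∖ 0)) + (t)`,
`rank P + d ≤ dim A`), `φ(w) ≠ 0` for `w ∈ P`. [cite: Niziol2006, Lemma 2.4] -/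
theorem chart_ne_zero_of_dform {t : Fin d → A} (hP : P.FG) (hφ0 : φ 0 = 1)
    (hφadd : ∀ a ∈ P, ∀ b ∈ P, φ (a + b) = φ a * φ b)
    (hφm : ∀ p ∈ P, p ≠ 0 → φ p ∈ maximalIdeal A) (ht : ∀ k, t k ∈ maximalIdeal A)
    (hgen : maximalIdeal A ≤ Ideal.span (φ '' {p | p ∈ P ∧ p ≠ 0}) ⊔ Ideal.span (Set.range t))
    (hdim : ((rank P + d : ℕ) : WithBot ℕ∞) ≤ ringKrullDim A) {w : Fin M →₀ ℕ} (hw : w ∈ P) :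
    φ w ≠ 0 := by
  have hdim' : ringKrullDim A = rank (absorbMonoid P d) := by
    rw [rank_absorbMonoid]
    exact le_antisymm (ringKrullDim_le_rank_add hP hφ0 hφadd hφm ht hgen) hdim
  have h := chart_ne_zero_of_dform0 (absorbMonoid_fg hP) (absorbChart_zero hφ0 t)
    (absorbChart_add hφadd t) (absorbChart_mem_maximalIdeal hφm ht)
    (maximalIdeal_le_span_absorbChart hφ0 hgen) hdim' (absorbGlue_mem hw 0)
  rwa [absorbChart_absorbGlue_zero] at h

end LogRegularCompleteStructure

namespace LogChart

universe v

/-- **Nizioł 2006, Lemma 2.4 (1) / Kato (4.1): chart elements are non-zero in the local rings of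
a log regular scheme.** For a chart `φ : P → A` by a finitely generated saturated `P ⊆ ℤⁿ`, log
regular at `𝔭`, and every `p ∈ P`, the image of `φ(p)` in `A_𝔭` is non-zero (and `A_𝔭` is a
domain, `isDomain_localization_of_isLogRegularAt`, so it is a non-zero-divisor).
[cite: Niziol2006, Lemma 2.4] [cite: Kato1994, Thm. (4.1)] -/
theorem algebraMap_val_ne_zero_of_isLogRegularAt {A : Type v} [CommRing A] [IsNoetherianRing A]
    {n : ℕ} {P : AddSubmonoid (Fin n → ℤ)} (hP : P.FG)
    (hsat : ∀ (v : Fin n → ℤ) (k : ℕ), 0 < k → k • v ∈ P → v ∈ P)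
    {φ : Multiplicative P →* A} {𝔭 : Ideal A} [𝔭.IsPrime] (hreg : IsLogRegularAt P φ 𝔭) (p : P) :
    algebraMap A (Localization.AtPrime 𝔭) (φ (Multiplicative.ofAdd p)) ≠ 0 := by
  obtain ⟨e, he, π, d, t, hD, hcompat⟩ := exists_dformData_of_isLogRegularAt'' hP hsat hreg
  obtain ⟨v, hv⟩ := hcompat p
  have hne := LogRegularCompleteStructure.chart_ne_zero_of_dform hD.fg hD.map_zero hD.map_add
    hD.mem_maximalIdeal hD.param_mem hD.gen hD.rank_le ((mem_embMonoid he).2 ⟨p, rfl⟩)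
  rw [← val_of_mem P φ p.2]
  intro h0
  rw [h0] at hv
  exact hne ((Units.mul_left_eq_zero v).1 hv)

end LogChart

end Literature.AlgebraicGeometry.Resolution
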